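import Summits.AtomisticToContinuum.BoseEinsteinCondensation.Theorems.BECRichardsonGaudinRichardsonAnchorBECBornDefs
import HarnessLib

/-!
# Crux `RichardsonAnchorBEC` (stmt-AtomisticToContinuum-14805), route `BECRichardsonGaudin`, line `registered` —
# stub `stub_bornPolyNorms` (U2a): Fock norms of the Born trial polynomial

For the Born trial polynomial of `…BornDefs`,
`A = Σ_{j ≤ J₁} Σ_{S ⊆ W₊, |S| = j} λ_j θ^S · X_0^{N−2j} ∏_{m∈S} X_m X_{−m}` over the band modes
`↥(momentumBand M)`, with `2J₁ + 2 ≤ N`, we prove (`stub_bornPolyNorms`):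

* `A` is homogeneous of degree `N` (`IsHomogeneous.sum`, `isHomogeneous_monomial`, the degree of the
  occupation index `pairIndex S` being `(N − 2|S|) + 2|S| = N`) and `A ≠ 0`;
* `‖A‖² = Re ⟨A, A⟩ = Σ_j λ_j² (N − 2j)! e_j` and `‖∂₀A‖² = Σ_j λ_j² (N − 2j)! (N − 2j) e_j`, where
  `e_j = pairEsymm L M R j = Σ_{|S| = j} ∏_{m∈S} θ_m²`: the sectors `(j, S)` have pairwise distinct
  occupation indices (`pairIndex` is injective on subsets of `W₊`, evaluating it at the band modes
  `toBand M m`, `m ∈ W₊`), so by the orthogonality of the occupation basis (`Fock.fockInner_monomial`)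
  only diagonal terms survive, with occupation factorials `(N − 2j)!` resp. `(N − 2j − 1)!`
  (`Fock.occFactorial_add_single`) and `∂₀ X^{pairIndex S} = (N − 2j) X^{pairIndex S − e₀}`
  (`pderiv_monomial`);
* the window bookkeeping: `W = B_M ∖ B_R` is symmetric and zero-free, exactly one of `±m` is
  lex-positive, so `Σ_{m∈W} f(m) = Σ_{m∈W₊} (f(m) + f(−m))` and `m ∈ W₊ ⇒ m ≠ 0, −m ∈ W ∖ W₊`.

Helper lemmas live in the sub-namespace `BornPolyNorms`. [folklore]
-/

noncomputable section

open MeasureTheory Filter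
open scoped ENNReal NNReal ComplexConjugate BigOperators

namespace Summit.AtomisticToContinuum.BoseEinsteinCondensation.Cruxes.RichardsonAnchorBEC.Birth

open Literature.MathematicalPhysics.QuantumManyBody.BoseGas
open MvPolynomial

namespace BornPolyNorms

/-! ## Window symmetry -/

/-- For `m ≠ 0` exactly one of `m`, `-m` is lex-positive. [folklore] -/
theorem lexPos_neg_iff {m : Momentum} (hm : m ≠ 0) : lexPos (-m) ↔ ¬ lexPos m := by
  have h3 : ¬ (m 0 = 0 ∧ m 1 = 0 ∧ m 2 = 0) := fun h => hm (by
    funext i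
    fin_cases i
    exacts [h.1, h.2.1, h.2.2])
  unfold lexPos
  simp only [Pi.neg_apply]
  omega

/-- Window symmetry: a window mode is nonzero and its time reversal is a window mode. [folklore] -/
theorem neg_mem_pairWindow {M R : ℕ} {m : Momentum} (hm : m ∈ pairWindow M R) :
    m ≠ 0 ∧ -m ∈ pairWindow M R := by
  unfold pairWindow at *
  rw [Finset.mem_sdiff] at hm ⊢
  refine ⟨fun h => hm.2 (h ▸ zero_mem_momentumBand R), neg_mem_momentumBand hm.1, fun h => hm.2 ?_⟩
  simpa using neg_mem_momentumBand h

/-- A representative `m ∈ W₊` is nonzero, `-m ∈ W`, and `-m ∉ W₊`. [folklore] -/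
theorem pairReps_neg {M R : ℕ} {m : Momentum} (hm : m ∈ pairReps M R) :
    m ≠ 0 ∧ -m ∈ pairWindow M R ∧ -m ∉ pairReps M R := by
  unfold pairReps at *
  rw [Finset.mem_filter] at hm
  obtain ⟨h0, hneg⟩ := neg_mem_pairWindow hm.1
  refine ⟨h0, hneg, fun h => ?_⟩
  rw [Finset.mem_filter] at h
  exact (lexPos_neg_iff h0).1 h.2 hm.2

/-- `Σ_{m ∈ W} f m = Σ_{m ∈ W₊} (f m + f (−m))`. [folklore] -/
theorem sum_pairWindow_eq_sum_pairReps {M R : ℕ} (f : Momentum → ℝ) :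
    ∑ m ∈ pairWindow M R, f m = ∑ m ∈ pairReps M R, (f m + f (-m)) := by
  rw [Finset.sum_add_distrib, pairReps,
    ← Finset.sum_filter_add_sum_filter_not (pairWindow M R) lexPos f]
  congr 1
  refine Finset.sum_nbij' (fun m => -m) (fun m => -m) ?_ ?_ (fun m _ => neg_neg m)
    (fun m _ => neg_neg m) (fun m _ => by rw [neg_neg])
  · intro m hm
    rw [Finset.mem_filter] at hm ⊢
    obtain ⟨h0, hneg⟩ := neg_mem_pairWindow hm.1
    exact ⟨hneg, (lexPos_neg_iff h0).2 hm.2⟩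
  · intro m hm
    rw [Finset.mem_filter] at hm ⊢
    obtain ⟨h0, hneg⟩ := neg_mem_pairWindow hm.1
    exact ⟨hneg, fun h => (lexPos_neg_iff h0).1 h hm.2⟩

/-! ## The occupation multi-index: evaluation, injectivity, factorial, degree -/

/-- `toBand M v = b ↔ v = b.1` for `v` in the band. [folklore] -/
theorem toBand_eq_iff {M : ℕ} {v : Momentum} (hv : v ∈ momentumBand M) (b : ↥(momentumBand M)) :
    toBand M v = b ↔ v = b.1 := by
  rw [Subtype.ext_iff, toBand_val hv]

/-- The occupation multi-index evaluated at a band mode `b`: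
`(N − 2|S|)·[b = 0] + [b ∈ S] + [−b ∈ S]`. [folklore] -/
theorem pairIndex_apply {M R N : ℕ} {S : Finset Momentum} (hS : S ⊆ pairReps M R)
    (b : ↥(momentumBand M)) :
    pairIndex M N S b = (if (0 : Momentum) = b.1 then N - 2 * S.card else 0) +
      ((if b.1 ∈ S then 1 else 0) + (if -b.1 ∈ S then 1 else 0)) := by
  have hW := stub_bornDefs M R
  have hband : ∀ m ∈ S, m ∈ momentumBand M ∧ -m ∈ momentumBand M := fun m hm =>
    ⟨hW.2.1 (hW.1 (hS hm)), hW.2.1 (pairReps_neg (hS hm)).2.1⟩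
  simp only [pairIndex, Finsupp.coe_add, Finsupp.coe_finsetSum, Pi.add_apply, Finset.sum_apply,
    Finset.sum_add_distrib, Finsupp.single_apply]
  refine congrArg₂ (· + ·) (if_congr (toBand_eq_iff (zero_mem_momentumBand M) b) rfl rfl)
    (congrArg₂ (· + ·) ?_ ?_)
  · rw [Finset.sum_congr rfl fun m hm => if_congr (toBand_eq_iff (hband m hm).1 b) rfl rfl]
    exact Finset.sum_ite_eq' S b.1 _
  · rw [Finset.sum_congr rfl fun m hm =>
      if_congr ((toBand_eq_iff (hband m hm).2 b).trans neg_eq_iff_eq_neg) rfl rfl]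
    exact Finset.sum_ite_eq' S (-b.1) _


/-- At the condensate mode: `(pairIndex S)(0) = N − 2|S|`. [folklore] -/
theorem pairIndex_apply_zero {M R N : ℕ} {S : Finset Momentum} (hS : S ⊆ pairReps M R) :
    pairIndex M N S (toBand M 0) = N - 2 * S.card := by
  have h0 : (0 : Momentum) ∉ S := fun h => (stub_bornDefs M R).2.2 ((stub_bornDefs M R).1 (hS h))
  rw [pairIndex_apply hS, toBand_val (zero_mem_momentumBand M), if_pos rfl, neg_zero, if_neg h0,
    add_zero, add_zero]

/-- At a representative `m ∈ W₊`: `(pairIndex S)(m) = [m ∈ S]`. [folklore] -/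
theorem pairIndex_apply_rep {M R N : ℕ} {S : Finset Momentum} (hS : S ⊆ pairReps M R)
    {m : Momentum} (hm : m ∈ pairReps M R) :
    pairIndex M N S (toBand M m) = if m ∈ S then 1 else 0 := by
  have hW := stub_bornDefs M R
  obtain ⟨h0, -, hnot⟩ := pairReps_neg hm
  rw [pairIndex_apply hS, toBand_val (hW.2.1 (hW.1 hm)), if_neg (Ne.symm h0),
    if_neg (fun h => hnot (hS h)), zero_add, add_zero]

/-- Off the condensate mode every exponent of `pairIndex S` is `≤ 1`. [folklore] -/
theorem pairIndex_apply_le_one {M R N : ℕ} {S : Finset Momentum} (hS : S ⊆ pairReps M R)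
    {b : ↥(momentumBand M)} (hb : b ≠ toBand M 0) : pairIndex M N S b ≤ 1 := by
  have hb' : (0 : Momentum) ≠ b.1 := fun h =>
    hb ((toBand_eq_iff (zero_mem_momentumBand M) b).2 h).symm
  rw [pairIndex_apply hS, if_neg hb', zero_add]
  by_cases h : b.1 ∈ S
  · rw [if_pos h, if_neg (fun h' => (pairReps_neg (hS h)).2.2 (hS h'))]
  · rw [if_neg h, zero_add]
    split_ifs <;> simp

/-- Injectivity of the occupation multi-index on subsets of `W₊` (one inclusion). [folklore] -/
theorem mem_of_pairIndex_eq {M R N : ℕ} {S S' : Finset Momentum} (hS : S ⊆ pairReps M R)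
    (hS' : S' ⊆ pairReps M R) (h : pairIndex M N S = pairIndex M N S') {m : Momentum}
    (hm : m ∈ S) : m ∈ S' := by
  by_contra hm'
  have h1 := pairIndex_apply_rep (N := N) hS (hS hm)
  rw [if_pos hm, h, pairIndex_apply_rep hS' (hS hm), if_neg hm'] at h1
  exact zero_ne_one h1

/-- Injectivity of the occupation multi-index on subsets of `W₊`. [folklore] -/
theorem pairIndex_injective {M R N : ℕ} {S S' : Finset Momentum} (hS : S ⊆ pairReps M R)
    (hS' : S' ⊆ pairReps M R) (h : pairIndex M N S = pairIndex M N S') : S = S' :=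
  Finset.Subset.antisymm (fun _ hm => mem_of_pairIndex_eq hS hS' h hm)
    fun _ hm => mem_of_pairIndex_eq hS' hS h.symm hm

/-- The occupation factorial of the sector `(j, S)` is `(N − 2j)!`. [folklore] -/
theorem occFactorial_pairIndex {M R N : ℕ} {S : Finset Momentum} (hS : S ⊆ pairReps M R) :
    Fock.occFactorial (pairIndex M N S) = (N - 2 * S.card).factorial := by
  unfold Fock.occFactorial Finsupp.prod
  rw [Finset.prod_eq_single (toBand M 0) (fun b _ hb => ?_) (fun h0 => ?_), pairIndex_apply_zero hS]
  · exact Nat.factorial_eq_one.2 (pairIndex_apply_le_one hS hb)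
  · rw [Finsupp.notMem_support_iff.1 h0]
    exact Nat.factorial_zero

/-- The sector `(j, S)` has `N` particles (when `2|S| ≤ N`). [folklore] -/
theorem degree_pairIndex {M N : ℕ} {S : Finset Momentum} (hS : 2 * S.card ≤ N) :
    (pairIndex M N S).degree = N := by
  simp only [pairIndex, map_add, map_sum, Finsupp.degree_single, Finset.sum_const, smul_eq_mul]
  omega

/-- The shifted index `pairIndex S − e₀` has occupation factorial `(N − 2|S| − 1)!`:
`occFactorial · (N − 2|S|) = (N − 2|S|)!`. [folklore] -/
theorem occFactorial_pairIndex_sub_mul {M R N : ℕ} {S : Finset Momentum} (hS : S ⊆ pairReps M R)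
    (hN : 2 * S.card < N) :
    Fock.occFactorial (pairIndex M N S - Finsupp.single (toBand M 0) 1) * (N - 2 * S.card) =
      (N - 2 * S.card).factorial := by
  have h0 := pairIndex_apply_zero (N := N) hS
  have hne : pairIndex M N S (toBand M 0) ≠ 0 := by rw [h0]; omega
  rw [← occFactorial_pairIndex hS]
  conv_rhs => rw [← Finsupp.sub_add_single_one_cancel hne, Fock.occFactorial_add_single,
    Finsupp.tsub_apply, Finsupp.single_eq_same, h0]
  congr 1
  omega

/-! ## Orthogonal families in the Fock inner product -/

/-- Additivity of the Fock inner product in the first argument over a finite sum. [folklore] -/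
theorem fockInner_sum_left {ι σ : Type*} (T : Finset σ) (p : σ → MvPolynomial ι ℂ)
    (q : MvPolynomial ι ℂ) :
    Fock.fockInner (∑ x ∈ T, p x) q = ∑ x ∈ T, Fock.fockInner (p x) q :=
  map_sum (AddMonoidHom.mk' (fun p => Fock.fockInner p q) fun p p' => Fock.fockInner_add_left p p' q)
    p T

/-- Additivity of the Fock inner product in the second argument over a finite sum. [folklore] -/
theorem fockInner_sum_right {ι σ : Type*} (T : Finset σ) (p : MvPolynomial ι ℂ)
    (q : σ → MvPolynomial ι ℂ) :
    Fock.fockInner p (∑ x ∈ T, q x) = ∑ x ∈ T, Fock.fockInner p (q x) :=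
  map_sum (AddMonoidHom.mk' (fun q => Fock.fockInner p q) fun q q' => Fock.fockInner_add_right p q q')
    q T

/-- **Pythagoras for an orthogonal family of occupation vectors**: if `d` is injective on `T`,
`⟨Σ_x a_x X^{d x}, Σ_x b_x X^{d x}⟩ = Σ_x (d x)! conj(a_x) b_x`. [folklore] -/
theorem fockInner_sum_monomial {ι σ : Type*} [DecidableEq ι] (T : Finset σ) {d : σ → ι →₀ ℕ}
    (hd : Set.InjOn d ↑T) (a b : σ → ℂ) :
    Fock.fockInner (∑ x ∈ T, monomial (d x) (a x)) (∑ x ∈ T, monomial (d x) (b x)) =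
      ∑ x ∈ T, (Fock.occFactorial (d x) : ℂ) * (conj (a x) * b x) := by
  rw [fockInner_sum_left]
  refine Finset.sum_congr rfl fun x hx => ?_
  rw [fockInner_sum_right, Finset.sum_eq_single_of_mem x hx fun y hy hne => ?_]
  · rw [Fock.fockInner_monomial, if_pos rfl]
  · rw [Fock.fockInner_monomial, if_neg fun h => hne (hd hy hx h.symm)]

/-- Real-coefficient form of `fockInner_sum_monomial`:
`‖Σ_x a_x X^{d x}‖² = Σ_x (d x)! a_x²` for an orthogonal family and real `a`. [folklore] -/
theorem fockInner_sum_monomial_re {ι σ : Type*} [DecidableEq ι] (T : Finset σ) {d : σ → ι →₀ ℕ}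
    (hd : Set.InjOn d ↑T) (a : σ → ℝ) :
    (Fock.fockInner (∑ x ∈ T, monomial (d x) (a x : ℂ)) (∑ x ∈ T, monomial (d x) (a x : ℂ))).re =
      ∑ x ∈ T, (Fock.occFactorial (d x) : ℝ) * a x ^ 2 := by
  rw [fockInner_sum_monomial T hd, Complex.re_sum]
  refine Finset.sum_congr rfl fun x _ => ?_
  rw [Complex.conj_ofReal, ← Complex.ofReal_mul, ← Complex.ofReal_natCast, ← Complex.ofReal_mul,
    Complex.ofReal_re, sq]

/-- The sectors `(j, S)`, `S ⊆ W₊`, `|S| = j ≤ J₁`, have pairwise distinct occupation indices.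
[folklore] -/
theorem pairIndex_injOn_sigma (M R N J₁ : ℕ) :
    Set.InjOn (fun x : (Σ _ : ℕ, Finset Momentum) => pairIndex M N x.2)
      ↑((Finset.range (J₁ + 1)).sigma fun j => (pairReps M R).powersetCard j) := by
  rintro ⟨j, S⟩ hx ⟨j', S'⟩ hy h
  rw [Finset.mem_coe, Finset.mem_sigma, Finset.mem_powersetCard] at hx hy
  obtain rfl : S = S' := pairIndex_injective hx.2.1 hy.2.1 h
  obtain rfl : j = j' := hx.2.2.symm.trans hy.2.2
  rfl

/-- The shifted indices `pairIndex S − e₀` of the sectors are pairwise distinct as well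
(no truncation since `N − 2J₁ ≥ 2`). [folklore] -/
theorem pairIndex_sub_injOn_sigma (M R N J₁ : ℕ) (hN : 2 * J₁ + 2 ≤ N) :
    Set.InjOn (fun x : (Σ _ : ℕ, Finset Momentum) =>
        pairIndex M N x.2 - Finsupp.single (toBand M 0) 1)
      ↑((Finset.range (J₁ + 1)).sigma fun j => (pairReps M R).powersetCard j) := by
  intro x hx y hy h
  refine pairIndex_injOn_sigma M R N J₁ hx hy ?_
  rw [Finset.mem_coe, Finset.mem_sigma, Finset.mem_range, Finset.mem_powersetCard] at hx hy
  have hx0 : pairIndex M N x.2 (toBand M 0) ≠ 0 := by rw [pairIndex_apply_zero hx.2.1]; omega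
  have hy0 : pairIndex M N y.2 (toBand M 0) ≠ 0 := by rw [pairIndex_apply_zero hy.2.1]; omega
  dsimp only at h ⊢
  rw [← Finsupp.sub_add_single_one_cancel hx0, h, Finsupp.sub_add_single_one_cancel hy0]


/-! ## The trial polynomial: norms, homogeneity, nonvanishing -/

/-- The trial polynomial as a single sum over the sectors `(j, S)`. [folklore] -/
theorem bornTrialPoly_eq_sum_sigma (γ L : ℝ) (M R N J₁ : ℕ) :
    bornTrialPoly γ L M R N J₁ =
      ∑ x ∈ (Finset.range (J₁ + 1)).sigma (fun j => (pairReps M R).powersetCard j),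
        monomial (pairIndex M N x.2)
          (((bornCoeff γ L M R N x.1 * ∏ m ∈ x.2, modeWeight L m : ℝ)) : ℂ) := by
  rw [bornTrialPoly, Finset.sum_sigma']

/-- **Fock norm of the trial polynomial**: `‖A‖² = Σ_j λ_j² (N − 2j)! e_j`. [folklore] -/
theorem fockInner_bornTrialPoly_re (γ L : ℝ) (M R N J₁ : ℕ) :
    (Fock.fockInner (bornTrialPoly γ L M R N J₁) (bornTrialPoly γ L M R N J₁)).re =
      ∑ j ∈ Finset.range (J₁ + 1),
        bornCoeff γ L M R N j ^ 2 * ((N - 2 * j).factorial : ℝ) * pairEsymm L M R j := by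
  rw [bornTrialPoly_eq_sum_sigma, fockInner_sum_monomial_re _ (pairIndex_injOn_sigma M R N J₁),
    Finset.sum_sigma]
  refine Finset.sum_congr rfl fun j _ => ?_
  rw [pairEsymm, Finset.mul_sum]
  refine Finset.sum_congr rfl fun S hS => ?_
  rw [Finset.mem_powersetCard] at hS
  obtain ⟨hS, rfl⟩ := hS
  dsimp only
  rw [occFactorial_pairIndex hS, Finset.prod_pow]
  ring

/-- `∂₀ A = Σ_{(j,S)} (N − 2j) λ_j θ^S X^{pairIndex S − e₀}`. [folklore] -/
theorem pderiv_bornTrialPoly (γ L : ℝ) (M R N J₁ : ℕ) :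
    pderiv (toBand M 0) (bornTrialPoly γ L M R N J₁) =
      ∑ x ∈ (Finset.range (J₁ + 1)).sigma (fun j => (pairReps M R).powersetCard j),
        monomial (pairIndex M N x.2 - Finsupp.single (toBand M 0) 1)
          (((bornCoeff γ L M R N x.1 * ∏ m ∈ x.2, modeWeight L m) * ((N - 2 * x.2.card : ℕ) : ℝ) :
            ℝ) : ℂ) := by
  rw [bornTrialPoly_eq_sum_sigma, map_sum]
  refine Finset.sum_congr rfl fun x hx => ?_
  rw [Finset.mem_sigma, Finset.mem_powersetCard] at hx
  rw [pderiv_monomial, pairIndex_apply_zero hx.2.1]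
  congr 1
  push_cast
  ring

/-- **Fock norm of `∂₀A`**: `‖∂₀A‖² = Σ_j λ_j² (N − 2j)! (N − 2j) e_j`. [folklore] -/
theorem fockInner_pderiv_bornTrialPoly_re (γ L : ℝ) (M R N J₁ : ℕ) (hN : 2 * J₁ + 2 ≤ N) :
    (Fock.fockInner (pderiv (toBand M 0) (bornTrialPoly γ L M R N J₁))
        (pderiv (toBand M 0) (bornTrialPoly γ L M R N J₁))).re =
      ∑ j ∈ Finset.range (J₁ + 1),
        bornCoeff γ L M R N j ^ 2 * ((N - 2 * j).factorial : ℝ) * ((N : ℝ) - 2 * j) *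
          pairEsymm L M R j := by
  rw [pderiv_bornTrialPoly, fockInner_sum_monomial_re _ (pairIndex_sub_injOn_sigma M R N J₁ hN),
    Finset.sum_sigma]
  refine Finset.sum_congr rfl fun j hj => ?_
  rw [Finset.mem_range] at hj
  rw [pairEsymm, Finset.mul_sum]
  refine Finset.sum_congr rfl fun S hS => ?_
  rw [Finset.mem_powersetCard] at hS
  obtain ⟨hS, rfl⟩ := hS
  have h2j : 2 * S.card ≤ N := by omega
  have hocc := occFactorial_pairIndex_sub_mul (N := N) hS (by omega)
  dsimp only
  rw [Finset.prod_pow, ← hocc]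
  push_cast [Nat.cast_sub h2j]
  ring

/-- The trial polynomial is homogeneous of degree `N` (an `N`-particle state). [folklore] -/
theorem isHomogeneous_bornTrialPoly (γ L : ℝ) (M R N J₁ : ℕ) (hN : 2 * J₁ + 2 ≤ N) :
    (bornTrialPoly γ L M R N J₁).IsHomogeneous N := by
  rw [bornTrialPoly]
  refine IsHomogeneous.sum _ _ _ fun j hj => IsHomogeneous.sum _ _ _ fun S hS =>
    isHomogeneous_monomial _ (degree_pairIndex ?_)
  rw [Finset.mem_powersetCard] at hS
  rw [Finset.mem_range] at hj
  rw [hS.2]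
  omega

/-- The trial polynomial is nonzero (its vacuum-pair sector `j = 0` is `X_0^N`). [folklore] -/
theorem bornTrialPoly_ne_zero (γ L : ℝ) (M R N J₁ : ℕ) : bornTrialPoly γ L M R N J₁ ≠ 0 := by
  intro h0
  have h := fockInner_bornTrialPoly_re γ L M R N J₁
  rw [h0, Fock.fockInner_zero_left, Complex.zero_re] at h
  have h1 : ∀ j ∈ Finset.range (J₁ + 1),
      0 ≤ bornCoeff γ L M R N j ^ 2 * ((N - 2 * j).factorial : ℝ) * pairEsymm L M R j :=
    fun j _ => mul_nonneg (mul_nonneg (sq_nonneg _) (Nat.cast_nonneg _))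
      (Finset.sum_nonneg fun S _ => Finset.prod_nonneg fun m _ => sq_nonneg _)
  have h2 := Finset.single_le_sum h1 (Finset.mem_range.2 (Nat.succ_pos J₁))
  rw [← h] at h2
  simp only [bornCoeff, pairEsymm, pow_zero, mul_zero, Nat.descFactorial_zero, Nat.cast_one,
    Nat.sub_zero, Finset.powersetCard_zero, Finset.sum_singleton, Finset.prod_empty, one_mul,
    mul_one, one_pow] at h2
  exact absurd h2 (not_le.2 (Nat.cast_pos.2 (Nat.factorial_pos N)))

end BornPolyNorms

/-! ## The registered stub -/

/-- **Stub U2a (`stub_bornPolyNorms`).** For the Born trial polynomial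
`A = Σ_{j ≤ J₁} Σ_{S ⊆ W₊, |S| = j} λ_j θ^S X_0^{N−2j} ∏_{m∈S} X_m X_{−m}` with `2J₁ + 2 ≤ N`:
`A` is homogeneous of degree `N` and nonzero; its Fock norm is `‖A‖² = Σ_j λ_j² (N−2j)! e_j` and
`‖a_0 A‖² = Σ_j λ_j² (N−2j)! (N−2j) e_j` (orthogonality of the occupation basis, the sectors having
pairwise distinct occupation indices with occupation factorials `(N−2j)!`, `(N−2j−1)!`); and the
window bookkeeping `Σ_W f = Σ_{W₊} (f(m) + f(−m))`, `m ∈ W₊ ⇒ m ≠ 0, −m ∈ W ∖ W₊`. [folklore] -/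
theorem stub_bornPolyNorms :
    ∀ (γ L : ℝ) (M R N J₁ : ℕ), 0 < L → 2 * J₁ + 2 ≤ N →
      (bornTrialPoly γ L M R N J₁).IsHomogeneous N ∧ bornTrialPoly γ L M R N J₁ ≠ 0 ∧
      (Fock.fockInner (bornTrialPoly γ L M R N J₁) (bornTrialPoly γ L M R N J₁)).re =
        ∑ j ∈ Finset.range (J₁ + 1),
          bornCoeff γ L M R N j ^ 2 * ((N - 2 * j).factorial : ℝ) * pairEsymm L M R j ∧
      (Fock.fockInner (MvPolynomial.pderiv (toBand M 0) (bornTrialPoly γ L M R N J₁))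
          (MvPolynomial.pderiv (toBand M 0) (bornTrialPoly γ L M R N J₁))).re =
        ∑ j ∈ Finset.range (J₁ + 1),
          bornCoeff γ L M R N j ^ 2 * ((N - 2 * j).factorial : ℝ) * ((N : ℝ) - 2 * j) * pairEsymm L M R j ∧
      (∀ f : Momentum → ℝ, ∑ m ∈ pairWindow M R, f m = ∑ m ∈ pairReps M R, (f m + f (-m))) ∧
      (∀ m ∈ pairReps M R, m ≠ 0 ∧ -m ∈ pairWindow M R ∧ -m ∉ pairReps M R) := by
  intro γ L M R N J₁ _hL hN
  exact ⟨BornPolyNorms.isHomogeneous_bornTrialPoly γ L M R N J₁ hN,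
    BornPolyNorms.bornTrialPoly_ne_zero γ L M R N J₁,
    BornPolyNorms.fockInner_bornTrialPoly_re γ L M R N J₁,
    BornPolyNorms.fockInner_pderiv_bornTrialPoly_re γ L M R N J₁ hN,
    fun f => BornPolyNorms.sum_pairWindow_eq_sum_pairReps f,
    fun m hm => BornPolyNorms.pairReps_neg hm⟩

end Summit.AtomisticToContinuum.BoseEinsteinCondensation.Cruxes.RichardsonAnchorBEC.Birth

end
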